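import Summits.QuantumFields.YangMills.Theorems.BalabanUVNodesN22LastCouplingHolo

/-!
# BalabanUVNodes ∕ N22 = NE9, THE QUANTITATIVE ROUTE IN THE LAST COUPLING — companion of `BalabanUVNodesN22LastCouplingHolo`: the (2.9)
# READING of the typed disc.  RELATIVE radii `c·t` (the discs the printed cut-off (2.9) supports) + the printed LINEAR vanishing at the vertex
# ([Balaban1987RG1] (2.13)–(2.14) p. 268 «the expression under the exponential above vanishes at g_k = 0») ⟹ the last-coupling Lipschitz letter
# of the localized term with a modulus BOUNDED down to `t → 0⁺`, by the weighted Cauchy estimate (Track A, DAG node N22; cluster K3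
# `SpineGivenEndpointR11`; seat `pub-ymgap-dag-n22-d`, R134 strategy s3)

HONEST FRAMING.  Count-neutral kernel bookkeeping over DISPLAYED hypotheses on the small-field tower `Step.SFTower` (nothing asserted about
Bałaban's functionals); NOT a node discharge; NE9 NOT IN PRINT; one finite four-torus programme at fixed ε; nothing continuum ∕ ℝ⁴ ∕ OS ∕ mass-gap ∕
Clay.  0 `sorry`, 0 `def`, standard axioms.  `--supports` item `SpineGivenEndpointR11` (route «BalabanUVNodes», rev 6).

WHY.  `BalabanUVNodesN22LastCouplingHolo` reads the typed disc `B12BetaHolo.EHoloAt` — a UNIFORM margin `r` about the whole of `[0, γ]`, the p. 266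
alternative cut-off's type — and gets the modulus `E₀∕r`.  With the printed cut-off (2.9) the last coupling is a dilation parameter
(`T4CouplingAnalyticity` header (L2)∕(L5)): no `g_k`-independent complex radius is available near the vertex, only the relative discs `D̄(t, c·t)`,
on which a bare sup letter `‖Ec‖ ≤ M` gives the Cauchy modulus `M∕(c·t)`, unbounded as `t → 0⁺`.  What print adds FOR THE LAST COUPLING is the
vanishing at `g_k = 0`, i.e. the sup letter `‖Ec z‖ ≤ E₁·t·e^{−κd}` on `D̄(t, c·t)`; the weighted Cauchy estimate
`T4CouplingAnalyticity.real_param_lipschitz_relW` (BY NAME) then gives the modulus `8E₁∕min(c, 1)`, bounded at the vertex: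
* `norm_sub_lastCoupling_le_of_relHolo` — **`‖E^{(k+1)}(X, g, φ) − E^{(k+1)}(X, g′, φ)‖ ≤ (8E₁∕min(c,1))·e^{−κ d_{k+1}(X)}·|g − g′|`** on `]0, γ]`;
* `norm_lastCoupling_le_of_relHolo` — the section itself is `≤ E₁·e^{−κd}·t` (linear approach to the vertex value);
* `norm_iteratedDeriv_lastCoupling_le_of_relHolo` — Cauchy at every order with a weight `t^p`: `‖Ec^{(n)}(t)‖ ≤ n!·E_p·e^{−κd}·t^p∕(c·t)^n`, bounded at
  the vertex iff `n ≤ p`; `norm_deriv_lastCoupling_le_of_relHolo` — `p = 1`: `‖Ec′(t)‖ ≤ (E₁∕c)·e^{−κd}` uniformly on `]0, γ]`.  LOCATED: the printed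
  vanishing is of order `p = 1` exactly (`B12ZeroCoupling268.norm_inv_sq_smul_le`: the shares of `𝐏^{(k)}` are `O(g)`), so ROAD 2's `C^{1,1}` letter
  (R) at age 0 is NOT vertex-uniform under (2.9) from these data (Cauchy gives `2E₁e^{−κd}∕(c²t)`); the Lipschitz letter does not need it;
* `weightedSupLetter_of_eHolo` — THE TWO READINGS ARE CONSISTENT: the uniform typed disc `B12BetaHolo.EHoloAt` plus the printed vertex value
  `E^{(k+1)}(X, 0, φ) = 0` ((2.14), displayed) gives the weighted relative letter with `E₁ = E₀(1 + 2c)∕r` (`c·γ < r∕2`).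
So BOTH printed cut-off readings deliver the s3 row «analyticity in the last coupling ⇒ Lipschitz via a Cauchy estimate on the typed disc» with
bounded, decay-carrying constants.  For OLDER couplings the same relative shape gives NO fading (`BalabanUVNodesN22KnitVertexWitness`, kernel
witness; `T4CouplingAnalyticity` §10) — for the last coupling only the modulus matters, and it is bounded.  Abstract-carrier form of this section:
`T4CouplingAnalyticity.ne9Window_of_couplingAnalyticRelLin` (pv10, §9).

References (TYPES only): [Balaban1987RG1] = T. Bałaban, Commun. Math. Phys. **109** (1987) 249–301 — (1.18) and the C^∞ ∕ analytic clause
p. 263, (2.9) p. 266, (2.13)–(2.14) p. 268.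
-/

noncomputable section

namespace Summit.QuantumFields.YangMills.BalabanUVNodes.N22LastCouplingHolo

open Set Metric Complex
open Literature.MathematicalPhysics.QuantumFieldTheory.Balaban1983to89
open Literature.MathematicalPhysics.QuantumFieldTheory.Balaban1983to89.Step
open Literature.MathematicalPhysics.QuantumFieldTheory.Balaban1983to89.T4CouplingAnalyticity (real_param_lipschitz_relW)

variable {P : Params} {G : Type*} [GaugeGroup G] {Φ 𝒢 : Type*} {T : SFTower P G Φ 𝒢} {c : SFConsts} {k : ℕ}

/-- **THE (2.9) READING: RELATIVE TYPED DISCS + LINEAR VANISHING AT THE VERTEX ⇒ A BOUNDED LAST-COUPLING MODULUS.**  If the section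
`t ↦ E^{(k+1)}(X, t, φ)` on `]0, γ]` is the trace of `Ec`, holomorphic on a set `D ⊇ D̄(t, c_r·t)` (`t ∈ ]0, γ]`, `c_r > 0`: the relative discs the
cut-off (2.9) supports), with the sup letter `‖Ec z‖ ≤ E₁·e^{−κ d_{k+1}(X)}·t` on `D̄(t, c_r·t)` (the printed vanishing at `g_k = 0` joined to (1.18)),
then for `g, g′ ∈ ]0, γ]`: **`‖E^{(k+1)}(X, g, φ) − E^{(k+1)}(X, g′, φ)‖ ≤ (8E₁∕min(c_r, 1))·e^{−κ d_{k+1}(X)}·|g − g′|`** — explicit in the two numbers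
`(E₁, c_r)` of the relative typed disc, bounded down to the vertex (`T4CouplingAnalyticity.real_param_lipschitz_relW` BY NAME).
[cite: Balaban1987RG1, (2.13)–(2.14) p.268 with (2.9) p.266 and p.263 (clause before (1.18))] -/
theorem norm_sub_lastCoupling_le_of_relHolo {cr E₁ : ℝ} (hcr : 0 < cr) (X : (T.sys (k + 1)).Dom) (φ : Φ)
    (Ec : ℂ → ℂ) (D : Set ℂ) (hhol : DifferentiableOn ℂ Ec D)
    (hD : ∀ t ∈ Ioc (0 : ℝ) c.γ, closedBall (t : ℂ) (cr * t) ⊆ D)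
    (hB : ∀ t ∈ Ioc (0 : ℝ) c.γ, ∀ z ∈ closedBall (t : ℂ) (cr * t),
      ‖Ec z‖ ≤ E₁ * Real.exp (-c.κ * (T.sys (k + 1)).dj X) * t)
    (heq : ∀ t ∈ Ioc (0 : ℝ) c.γ, T.E (k + 1) X t φ = Ec t)
    {g g' : ℝ} (hg : g ∈ Ioc (0 : ℝ) c.γ) (hg' : g' ∈ Ioc (0 : ℝ) c.γ) :
    ‖T.E (k + 1) X g φ - T.E (k + 1) X g' φ‖ ≤
      8 * (E₁ * Real.exp (-c.κ * (T.sys (k + 1)).dj X)) / min cr 1 * |g - g'| := by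
  wlog hle : g ≤ g' generalizing g g'
  · have h := this hg' hg (not_le.mp hle).le
    rwa [norm_sub_rev, abs_sub_comm] at h
  have hsub : Icc g g' ⊆ Ioc (0 : ℝ) c.γ := fun s hs => ⟨hg.1.trans_le hs.1, hs.2.trans hg'.2⟩
  have h := real_param_lipschitz_relW (g := Ec) hg.1 hle hcr hhol (fun s hs => hD s (hsub hs))
    (fun s hs z hz => hB s (hsub hs) z hz)
  rw [heq g hg, heq g' hg']
  exact h

/-- **THE VERTEX VALUE IS APPROACHED LINEARLY**: under the same sup letter, `‖E^{(k+1)}(X, t, φ)‖ ≤ E₁·e^{−κ d_{k+1}(X)}·t` on `]0, γ]` — the section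
tends to `0` at the vertex at a linear rate ((2.14): the `g_k = 0` value is the normalization, subtracted). [cite: Balaban1987RG1, (2.13)–(2.14) p.268] -/
theorem norm_lastCoupling_le_of_relHolo {cr E₁ : ℝ} (hcr : 0 < cr) (X : (T.sys (k + 1)).Dom) (φ : Φ) (Ec : ℂ → ℂ)
    (hB : ∀ t ∈ Ioc (0 : ℝ) c.γ, ∀ z ∈ closedBall (t : ℂ) (cr * t),
      ‖Ec z‖ ≤ E₁ * Real.exp (-c.κ * (T.sys (k + 1)).dj X) * t)
    (heq : ∀ t ∈ Ioc (0 : ℝ) c.γ, T.E (k + 1) X t φ = Ec t) {t : ℝ} (ht : t ∈ Ioc (0 : ℝ) c.γ) :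
    ‖T.E (k + 1) X t φ‖ ≤ E₁ * Real.exp (-c.κ * (T.sys (k + 1)).dj X) * t := by
  rw [heq t ht]
  exact hB t ht _ (mem_closedBall_self (mul_nonneg hcr.le ht.1.le))

/-- **CAUCHY ON THE RELATIVE DISC, EVERY ORDER, WITH A VANISHING WEIGHT `t^p`**: if `Ec` is holomorphic on `D ⊇ D̄(t, c_r·t)` with
`‖Ec‖ ≤ E_p·e^{−κ d_{k+1}(X)}·t^p` there (`t ∈ ]0, γ]`), then `‖Ec^{(n)}(t)‖ ≤ n!·(E_p·e^{−κd}·t^p)∕(c_r·t)^n` — of order `t^{p−n}`: bounded down to the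
vertex iff `n ≤ p`.  LOCATED READING: the printed vanishing at `g_k = 0` is of order `p = 1` exactly (the shares `(1∕g²)F(gX)`, `F = O(‖·‖³)`, of
`𝐏^{(k)}` are `O(g)`: `B12ZeroCoupling268.norm_inv_sq_smul_le`), so under (2.9) the first `g_k`-derivative is vertex-uniform (`n = 1`, next theorem)
while the Cauchy bound for the second is `2E₁e^{−κd}∕(c_r²·t)` — ROAD 2's `C^{1,1}` letter (R) at age 0 is NOT vertex-uniform from these data
(order-2 vanishing would be needed); the Lipschitz letter above does not use it. [cite: Balaban1987RG1, (2.13)–(2.14) p.268 with (2.9) p.266] -/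
theorem norm_iteratedDeriv_lastCoupling_le_of_relHolo {cr E : ℝ} {p : ℕ} (hcr : 0 < cr) (X : (T.sys (k + 1)).Dom)
    (Ec : ℂ → ℂ) (D : Set ℂ) (hhol : DifferentiableOn ℂ Ec D)
    (hD : ∀ t ∈ Ioc (0 : ℝ) c.γ, closedBall (t : ℂ) (cr * t) ⊆ D)
    (hB : ∀ t ∈ Ioc (0 : ℝ) c.γ, ∀ z ∈ closedBall (t : ℂ) (cr * t),
      ‖Ec z‖ ≤ E * Real.exp (-c.κ * (T.sys (k + 1)).dj X) * t ^ p)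
    (n : ℕ) {t : ℝ} (ht : t ∈ Ioc (0 : ℝ) c.γ) :
    ‖iteratedDeriv n Ec t‖ ≤ n.factorial * (E * Real.exp (-c.κ * (T.sys (k + 1)).dj X) * t ^ p) / (cr * t) ^ n := by
  have hr : 0 < cr * t := mul_pos hcr ht.1
  exact Complex.norm_iteratedDeriv_le_of_forall_mem_sphere_norm_le n hr (hhol.diffContOnCl_ball (hD t ht))
    fun w hw => hB t ht w (sphere_subset_closedBall hw)

/-- **THE FIRST `g_k`-DERIVATIVE IS VERTEX-UNIFORM UNDER (2.9)**: with the order-1 weight (`p = 1`), `‖Ec′(t)‖ ≤ (E₁∕c_r)·e^{−κ d_{k+1}(X)}` for every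
`t ∈ ]0, γ]` — the derivative-level form of `norm_sub_lastCoupling_le_of_relHolo` (Cauchy at the centre of the relative disc).
[cite: Balaban1987RG1, (2.13)–(2.14) p.268 with (2.9) p.266 and p.263 (clause before (1.18))] -/
theorem norm_deriv_lastCoupling_le_of_relHolo {cr E₁ : ℝ} (hcr : 0 < cr) (X : (T.sys (k + 1)).Dom)
    (Ec : ℂ → ℂ) (D : Set ℂ) (hhol : DifferentiableOn ℂ Ec D)
    (hD : ∀ t ∈ Ioc (0 : ℝ) c.γ, closedBall (t : ℂ) (cr * t) ⊆ D)
    (hB : ∀ t ∈ Ioc (0 : ℝ) c.γ, ∀ z ∈ closedBall (t : ℂ) (cr * t),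
      ‖Ec z‖ ≤ E₁ * Real.exp (-c.κ * (T.sys (k + 1)).dj X) * t)
    {t : ℝ} (ht : t ∈ Ioc (0 : ℝ) c.γ) :
    ‖deriv Ec t‖ ≤ E₁ / cr * Real.exp (-c.κ * (T.sys (k + 1)).dj X) := by
  have hB' : ∀ s ∈ Ioc (0 : ℝ) c.γ, ∀ z ∈ closedBall (s : ℂ) (cr * s),
      ‖Ec z‖ ≤ E₁ * Real.exp (-c.κ * (T.sys (k + 1)).dj X) * s ^ 1 := by
    simpa only [pow_one] using hB
  have h := norm_iteratedDeriv_lastCoupling_le_of_relHolo (p := 1) hcr X Ec D hhol hD hB' 1 ht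
  rw [iteratedDeriv_one] at h
  have ht0 : 0 < t := ht.1
  have e : (Nat.factorial 1 : ℝ) * (E₁ * Real.exp (-c.κ * (T.sys (k + 1)).dj X) * t ^ 1) / (cr * t) ^ 1
      = E₁ / cr * Real.exp (-c.κ * (T.sys (k + 1)).dj X) := by
    rw [Nat.factorial_one, Nat.cast_one, one_mul, pow_one, pow_one]
    field_simp
  rw [e] at h
  exact h

/-! ## The two readings are consistent: a UNIFORM typed disc plus the vertex zero (2.14) gives the (2.9) reading's weighted letter -/

section Bridge

open Literature.MathematicalPhysics.QuantumFieldTheory.Balaban1983to89.B12BetaHolo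

/-- **p. 266's UNIFORM DISC + THE VERTEX ZERO ⇒ THE (2.9) READING's WEIGHTED SUP LETTER.**  From `S : EHoloAt T c k` (uniform margin `r`, (1.18)
constant `E₀`, `γ > 0`), the printed vertex value `E^{(k+1)}(X, 0, φ) = 0` ((2.13)–(2.14): at `g_k = 0` the integrand is `1` and the normalization
is subtracted — DISPLAYED), and a ratio `c_r > 0` with `c_r·γ < r∕2`: on every relative disc `D̄(t, c_r·t)`, `t ∈ ]0, γ]`,
**`‖Ec z‖ ≤ (E₀(1 + 2c_r)∕r)·e^{−κ d_{k+1}(X)}·t`** — the hypothesis `hB` of `norm_sub_lastCoupling_le_of_relHolo` with `E₁ = E₀(1 + 2c_r)∕r`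
(Lipschitz letter on `[0, γ]` from the vertex + the complex two-point letter on `D(t, r∕2)`).  So every world carrying the uniform typed disc
carries the relative one; the converse is the vertex question and is not claimed. [cite: Balaban1987RG1, (2.13)–(2.14) p.268 with p.266 (after (2.9)) and (1.18) p.263] -/
theorem weightedSupLetter_of_eHolo (hγ : 0 < c.γ) (S : EHoloAt T c k) (X : (T.sys (k + 1)).Dom) {φ : Φ}
    (hφ : φ ∈ T.space (k + 1) X c.α₀ c.α₁) (h0 : T.E (k + 1) X 0 φ = 0) {cr : ℝ} (hcr : 0 < cr)
    (hcrγ : cr * c.γ < S.r / 2) :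
    ∀ t ∈ Ioc (0 : ℝ) c.γ, ∀ z ∈ closedBall (t : ℂ) (cr * t),
      ‖S.Ec X φ z‖ ≤ S.E₀ * (1 + 2 * cr) / S.r * Real.exp (-c.κ * (T.sys (k + 1)).dj X) * t := by
  intro t ht z hz
  set w : ℝ := Real.exp (-c.κ * (T.sys (k + 1)).dj X) with hw
  have htI : t ∈ Icc (0 : ℝ) c.γ := ⟨ht.1.le, ht.2⟩
  have h0I : (0 : ℝ) ∈ Icc (0 : ℝ) c.γ := ⟨le_rfl, hγ.le⟩
  -- the real point: Lipschitz from the vertex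
  have hreal : ‖S.Ec X φ t‖ ≤ S.E₀ / S.r * w * t := by
    have h := norm_sub_lastCoupling_le_of_eHolo hγ S X hφ htI h0I
    rw [h0, sub_zero, sub_zero, abs_of_pos ht.1, S.eq X φ hφ t htI] at h
    exact h
  -- the complex displacement inside `D(t, r∕2)`
  have hzball : z ∈ ball (t : ℂ) (S.r / 2) := by
    have h1 : cr * t ≤ cr * c.γ := mul_le_mul_of_nonneg_left ht.2 hcr.le
    exact closedBall_subset_ball (by linarith) hz
  have htball : (t : ℂ) ∈ ball (t : ℂ) (S.r / 2) := mem_ball_self (by linarith [S.r_pos])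
  have hcx : ‖S.Ec X φ z - S.Ec X φ t‖ ≤ 2 * S.E₀ / S.r * w * ‖z - (t : ℂ)‖ :=
    norm_sub_lastCoupling_complex_le_of_eHolo S X hφ htI hzball htball
  have hzt : ‖z - (t : ℂ)‖ ≤ cr * t := by rwa [mem_closedBall, dist_eq_norm] at hz
  have hE₀ : 0 ≤ S.E₀ := eHolo_E₀_nonneg S X hφ hγ.le
  have hcoef : 0 ≤ 2 * S.E₀ / S.r * w := by
    have := S.r_pos
    positivity
  calc ‖S.Ec X φ z‖ ≤ ‖S.Ec X φ z - S.Ec X φ t‖ + ‖S.Ec X φ t‖ := norm_le_norm_sub_add _ _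
    _ ≤ 2 * S.E₀ / S.r * w * (cr * t) + S.E₀ / S.r * w * t :=
        add_le_add (hcx.trans (mul_le_mul_of_nonneg_left hzt hcoef)) hreal
    _ = S.E₀ * (1 + 2 * cr) / S.r * w * t := by ring

end Bridge

end Summit.QuantumFields.YangMills.BalabanUVNodes.N22LastCouplingHolo

end
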